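import Summits.HubbardSuperconductivity.HubbardSuperconductivity.Theorems.AposterioriCapRgSsbToEvenTorusLroLadderInductionStep
import HarnessLib

/-!
# Route `AposterioriCapRg` — crux `SsbToEvenTorusLro` (stmt-HubbardSuperconductivity-1315),
# line `floating-mu-two-sided-pair-transfer`, stub `stub_ladderInduction`: the FIXED-`L` LADDER

Helper file 2/3 of the INDUCTION stub (file 1/3 = `…LadderInductionStep`, the one-rung steps; file
3/3 = `…LadderInduction`, constants and `∀ᶠ`). Fix `U`, a side `L ≥ 1`, write
`H = hubbardTorus 2 L 1 U`, `P = pairField dWaveFormFactor L`, `Q = PᴴP`, `E_k = H.minEnergyOn (szSector k 0)`,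
`V_k(τ)` the low manifold of the sector `k`, and let
`G m F := ∀ ψ, IsGroundStateInSector H m 0 ψ → ‖ψ‖² = 1 → F ≤ Re⟨ψ,Qψ⟩` ("the sector `m` has pair floor `F`").

* `lil_rung_mono` — the six RUNG conjuncts are monotone in their constant (`Re⟨ψ,Qψ⟩ ≥ 0`), so the RUNG
  constant may be taken `≥ 0`.
* `lil_seed_floor` (registered closed form `stub_ladderSeedStep`) — the SEED STEP: one bright (`≥ B`) unit vector of excess `≤ θ₀` in the sector `m₀` plus
  `ρL⁴`-rigidity of `Q` on `V_{m₀}(τ)` give `G m₀ (B − 4ρL⁴ − K(θ₀/τ)L⁴)` (one TRANSFER + "a ground state lies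
  in its low manifold").
* `lil_ladder_fixedL` — the LADDER AT FIXED `L`: with the TRANSFER (constant `K ≥ 0`) and the abstract CHAINS
  (stub `stub_ladderInductionChains`) as hypotheses, RUNG (constant `C_r ≥ 0`), window convexity (slack `s`)
  and rigidity (`ρ`, tolerance `τ`) available on the window of even sectors between `m₀` and `N`, a start
  `G m₀ F₀`, and the budget `F_min ≤ F₀ − J'ℓ` (`0 ≤ 2J' ≤ W`, `|m₀ − N| ≤ W`) for the per-rung loss
  `ℓ = C_rL² + 4ρL⁴ + K(θ/τ)L⁴`, conclude `G N F_min` — CHAINS run with the landed one-rung steps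
  `stub_ladderInductionRungDown/Up` (numeric side conditions: `0 ≤ s ≤ 1`, `0 < F_min`, `2C_rL² ≤ F_min`,
  `0 < τ`, `0 ≤ ρ`, `s + 4C_rL²/F_min ≤ θ`, `2θ ≤ τ`, `max m₀ N + 2 ≤ 2L²`, `2 ≤ m₀`).

Finite-dimensional bookkeeping over landed tree lemmas; no definition and no named fact is introduced.
Sources: T. Koma, H. Tasaki, J. Stat. Phys. 76 (1994) 745, §2 (tower of states); H. Tasaki, *Physics and
Mathematics of Quantum Many-Body Systems* (2020) §2.2. All statements are folklore.
-/

noncomputable section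

namespace Summit.HubbardSuperconductivity.HubbardSuperconductivity.Theorems

-- summit = problem name (single-conjunct summit), D-0017
set_option linter.dupNamespace false

open Literature.MathematicalPhysics.QuantumLattice Literature.Probability.LatticeModels
open Filter Set Matrix
open scoped ComplexOrder ComplexConjugate

/-! ## §1 Monotonicity of the RUNG in its constant -/

/-- `Re⟨ψ, PᴴP ψ⟩ ≥ 0` (a Gram square). [folklore] -/
theorem lil_re_expect_gram_nonneg {L : ℕ} (P : Matrix (Finset (Orb (FermionTorus 2 L))) (Finset (Orb (FermionTorus 2 L))) ℂ)
    (ψ : Fock (Orb (FermionTorus 2 L))) : 0 ≤ (expect (Pᴴ * P) ψ).re := by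
  rw [PosSemidefTrace.expect_conjTranspose_mul]
  exact (Complex.nonneg_iff.1 (dotProduct_star_self_nonneg _)).1

/-- **The six RUNG conjuncts are monotone in the constant**: if they hold with `C` they hold with any
`Cr ≥ C` (the pair order `Re⟨ψ,PᴴPψ⟩` is `≥ 0`). [folklore] -/
theorem lil_rung_mono {U : ℝ} {L : ℕ} [NeZero L] {n : ℕ} {ψ : Fock (Orb (FermionTorus 2 L))} {C Cr : ℝ} (hC : C ≤ Cr)
    (h : pairField dWaveFormFactor L *ᵥ ψ ∈ szSector n 0 ∧ (pairField dWaveFormFactor L)ᴴ *ᵥ ψ ∈ szSector (n + 4) 0 ∧ (expect (hubbardTorus 2 L 1 U) (pairField dWaveFormFactor L *ᵥ ψ)).re - (hubbardTorus 2 L 1 U).minEnergyOn (szSector n 0) * (expect ((pairField dWaveFormFactor L)ᴴ * pairField dWaveFormFactor L) ψ).re + ((expect (hubbardTorus 2 L 1 U) ((pairField dWaveFormFactor L)ᴴ *ᵥ ψ)).re - (hubbardTorus 2 L 1 U).minEnergyOn (szSector (n + 4) 0) * (expect (pairField dWaveFormFactor L * (pairField dWaveFormFactor L)ᴴ) ψ).re)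 ≤ C * (L : ℝ) ^ 2 + max 0 (2 * (hubbardTorus 2 L 1 U).minEnergyOn (szSector (n + 2) 0) - (hubbardTorus 2 L 1 U).minEnergyOn (szSector n 0) - (hubbardTorus 2 L 1 U).minEnergyOn (szSector (n + 4) 0)) * (expect ((pairField dWaveFormFactor L)ᴴ * pairField dWaveFormFactor L) ψ).re ∧ (expect ((pairField dWaveFormFactor L)ᴴ * pairField dWaveFormFactor L) ψ).re ^ 2 - C * (L : ℝ) ^ 2 * (expect ((pairField dWaveFormFactor L)ᴴ * pairField dWaveFormFactor L) ψ).re ≤ (expect ((pairField dWaveFormFactor L)ᴴ * pairField dWaveFormFactor L) (pairField dWaveFormFactor L *ᵥ ψ)).re ∧ (expect (pairField dWaveFormFactor L * (pairField dWaveFormFactor L)ᴴ) ψ).re ^ 2 ≤ (expect ((pairField dWaveFormFactor L)ᴴ * pairField dWaveFormFactor L) ((pairField dWaveFormFactor L)ᴴ *ᵥ ψ)).re ∧ |(expect (pairField dWaveFormFactor L * (pairField dWaveFormFactor L)ᴴ) ψ).re - (expect ((pairField dWaveFormFactor L)ᴴ * pairField dWaveFormFactor L) ψ).re| ≤ C *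 (L : ℝ) ^ 2) :
    pairField dWaveFormFactor L *ᵥ ψ ∈ szSector n 0 ∧ (pairField dWaveFormFactor L)ᴴ *ᵥ ψ ∈ szSector (n + 4) 0 ∧ (expect (hubbardTorus 2 L 1 U) (pairField dWaveFormFactor L *ᵥ ψ)).re - (hubbardTorus 2 L 1 U).minEnergyOn (szSector n 0) * (expect ((pairField dWaveFormFactor L)ᴴ * pairField dWaveFormFactor L) ψ).re + ((expect (hubbardTorus 2 L 1 U) ((pairField dWaveFormFactor L)ᴴ *ᵥ ψ)).re - (hubbardTorus 2 L 1 U).minEnergyOn (szSector (n + 4) 0) * (expect (pairField dWaveFormFactor L * (pairField dWaveFormFactor L)ᴴ) ψ).re) ≤ Cr * (L : ℝ) ^ 2 + max 0 (2 * (hubbardTorus 2 L 1 U).minEnergyOn (szSector (n + 2) 0) - (hubbardTorus 2 L 1 U).minEnergyOn (szSector n 0) - (hubbardTorus 2 L 1 U).minEnergyOn (szSector (n + 4) 0)) * (expect ((pairField dWaveFormFactor L)ᴴ * pairField dWaveFormFactor L) ψ).re ∧ (expect ((pairField dWaveFormFactor L)ᴴ * pairField dWaveFormFactor L) ψ).re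 ^ 2 - Cr * (L : ℝ) ^ 2 * (expect ((pairField dWaveFormFactor L)ᴴ * pairField dWaveFormFactor L) ψ).re ≤ (expect ((pairField dWaveFormFactor L)ᴴ * pairField dWaveFormFactor L) (pairField dWaveFormFactor L *ᵥ ψ)).re ∧ (expect (pairField dWaveFormFactor L * (pairField dWaveFormFactor L)ᴴ) ψ).re ^ 2 ≤ (expect ((pairField dWaveFormFactor L)ᴴ * pairField dWaveFormFactor L) ((pairField dWaveFormFactor L)ᴴ *ᵥ ψ)).re ∧ |(expect (pairField dWaveFormFactor L * (pairField dWaveFormFactor L)ᴴ) ψ).re - (expect ((pairField dWaveFormFactor L)ᴴ * pairField dWaveFormFactor L) ψ).re| ≤ Cr * (L : ℝ) ^ 2 := by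
  obtain ⟨h1, h2, h3, h4, h5, h6⟩ := h
  have hQ := lil_re_expect_gram_nonneg (pairField dWaveFormFactor L) ψ
  have hL : (0 : ℝ) ≤ (L : ℝ) ^ 2 := by positivity
  have hCL : C * (L : ℝ) ^ 2 ≤ Cr * (L : ℝ) ^ 2 := mul_le_mul_of_nonneg_right hC hL
  refine ⟨h1, h2, ?_, ?_, h5, h6.trans hCL⟩
  · linarith only [h3, hCL]
  · have : C * (L : ℝ) ^ 2 * (expect ((pairField dWaveFormFactor L)ᴴ * pairField dWaveFormFactor L) ψ).re ≤
        Cr * (L : ℝ) ^ 2 * (expect ((pairField dWaveFormFactor L)ᴴ * pairField dWaveFormFactor L) ψ).re :=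
      mul_le_mul_of_nonneg_right hCL hQ
    linarith only [h4, this]

/-! ## §2 The seed step -/

/-- **SEED STEP.** With the TRANSFER (constant `K`) as hypothesis: one unit vector `φ ∈ szSector m₀ 0` of
excess `≤ θ₀` and pair order `≥ B`, plus `ρL⁴`-rigidity of `PᴴP` on `V_{m₀}(τ)` (`0 < τ`, `0 ≤ ρ`,
`0 ≤ θ₀`, `2θ₀ ≤ τ`), give the floor `B − 4ρL⁴ − K(θ₀/τ)L⁴` for EVERY normalised ground state of the
sector `m₀` (a ground state lies in its own low manifold). [folklore] -/
theorem lil_seed_floor {K : ℝ} (hT : (∀ (U : ℝ) (L : ℕ) [NeZero L] (n : ℕ) (τ ρ θ B lam : ℝ), 0 < τ → 0 ≤ ρ → 0 ≤ θ → 2 * θ ≤ τ → (∀ v ∈ Submodule.span ℂ {φ : Fock (Orb (FermionTorus 2 L)) | φ ∈ szSector n 0 ∧ ∃ E : ℝ, hubbardTorus 2 L 1 U *ᵥ φ = (E : ℂ) • φ ∧ E ≤ (hubbardTorus 2 L 1 U).minEnergyOn (szSector n 0) + τ}, (star (((pairField dWaveFormFactor L)ᴴ * pairField dWaveFormFactor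 L) *ᵥ v - ((lam * (L : ℝ) ^ 4 : ℝ) : ℂ) • v) ⬝ᵥ (((pairField dWaveFormFactor L)ᴴ * pairField dWaveFormFactor L) *ᵥ v - ((lam * (L : ℝ) ^ 4 : ℝ) : ℂ) • v)).re ≤ ρ ^ 2 * (L : ℝ) ^ 8 * (star v ⬝ᵥ v).re) → ∀ φ : Fock (Orb (FermionTorus 2 L)), φ ∈ szSector n 0 → star φ ⬝ᵥ φ = 1 → (expect (hubbardTorus 2 L 1 U) φ).re ≤ (hubbardTorus 2 L 1 U).minEnergyOn (szSector n 0) + θ → B ≤ (expect ((pairField dWaveFormFactor L)ᴴ * pairField dWaveFormFactor L) φ).re → ∀ u ∈ Submodule.span ℂ {φ : Fock (Orb (FermionTorus 2 L)) | φ ∈ szSector n 0 ∧ ∃ E : ℝ, hubbardTorus 2 L 1 U *ᵥ φ = (E : ℂ) • φ ∧ E ≤ (hubbardTorus 2 L 1 U).minEnergyOn (szSector n 0) + τ}, star u ⬝ᵥ u = 1 → B - 4 * ρ * (L : ℝ) ^ 4 - K * (θ / τ) * (L : ℝ) ^ 4 ≤ (expect ((pairField dWaveFormFactor L)ᴴ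 * pairField dWaveFormFactor L) u).re))
    (U : ℝ) (L : ℕ) [NeZero L] (m : ℕ) {τ ρ θ₀ B lam : ℝ} (hτ : 0 < τ) (hρ : 0 ≤ ρ) (hθ : 0 ≤ θ₀)
    (hθτ : 2 * θ₀ ≤ τ) (hrig : (∀ v ∈ Submodule.span ℂ {φ : Fock (Orb (FermionTorus 2 L)) | φ ∈ szSector m 0 ∧ ∃ E : ℝ, hubbardTorus 2 L 1 U *ᵥ φ = (E : ℂ) • φ ∧ E ≤ (hubbardTorus 2 L 1 U).minEnergyOn (szSector m 0) + τ}, (star (((pairField dWaveFormFactor L)ᴴ * pairField dWaveFormFactor L) *ᵥ v - ((lam * (L : ℝ) ^ 4 : ℝ) : ℂ) • v) ⬝ᵥ (((pairField dWaveFormFactor L)ᴴ * pairField dWaveFormFactor L) *ᵥ v - ((lam * (L : ℝ) ^ 4 : ℝ) : ℂ) • v)).re ≤ ρ ^ 2 * (L : ℝ) ^ 8 * (star v ⬝ᵥ v).re))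
    {φ : Fock (Orb (FermionTorus 2 L))} (hφ : φ ∈ szSector m 0) (hφ1 : star φ ⬝ᵥ φ = 1)
    (hφE : (expect (hubbardTorus 2 L 1 U) φ).re ≤ (hubbardTorus 2 L 1 U).minEnergyOn (szSector m 0) + θ₀)
    (hφB : B ≤ (expect ((pairField dWaveFormFactor L)ᴴ * pairField dWaveFormFactor L) φ).re) :
    ∀ ψ : Fock (Orb (FermionTorus 2 L)), IsGroundStateInSector (hubbardTorus 2 L 1 U) m 0 ψ →
      star ψ ⬝ᵥ ψ = 1 →
      B - 4 * ρ * (L : ℝ) ^ 4 - K * (θ₀ / τ) * (L : ℝ) ^ 4 ≤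
        (expect ((pairField dWaveFormFactor L)ᴴ * pairField dWaveFormFactor L) ψ).re :=
  fun ψ hψ hψ1 => hT U L m τ ρ θ₀ B lam hτ hρ hθ hθτ hrig φ hφ hφ1 hφE hφB ψ
    (lis_groundState_mem_lowManifold hτ.le hψ) hψ1

/-! ## §3 The ladder at fixed `L` -/

/-- **THE LADDER AT FIXED `L`.** See the module docstring. Hypotheses: the TRANSFER (constant `K ≥ 0`),
the abstract CHAINS (stub `stub_ladderInductionChains`), even `N`, `m₀` with `|m₀ − N| ≤ W`, `2 ≤ m₀`,
`max m₀ N + 2 ≤ 2L²`; on the window of even sectors between `m₀` and `N`: the six RUNG conjuncts with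
constant `C_r ≥ 0` for every normalised ground state of the middle sector, the convexity slack `≤ s`,
and `ρL⁴`-rigidity of `PᴴP` on the low manifold `V_m(τ)`; numeric side conditions `0 ≤ s ≤ 1`,
`0 < F_min`, `2C_rL² ≤ F_min`, `0 < τ`, `0 ≤ ρ`, `s + 4C_rL²/F_min ≤ θ`, `2θ ≤ τ`; the start floor `F₀` in
the sector `m₀`; and the budget `F_min ≤ F₀ − J'(C_rL² + 4ρL⁴ + K(θ/τ)L⁴)` for `0 ≤ 2J' ≤ W`. Conclusion:
every normalised ground state of the sector `N` has pair order `≥ F_min`. Koma–Tasaki (1994) §2. [folklore] -/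
theorem lil_ladder_fixedL {K : ℝ} (hK : 0 ≤ K) (hT : (∀ (U : ℝ) (L : ℕ) [NeZero L] (n : ℕ) (τ ρ θ B lam : ℝ), 0 < τ → 0 ≤ ρ → 0 ≤ θ → 2 * θ ≤ τ → (∀ v ∈ Submodule.span ℂ {φ : Fock (Orb (FermionTorus 2 L)) | φ ∈ szSector n 0 ∧ ∃ E : ℝ, hubbardTorus 2 L 1 U *ᵥ φ = (E : ℂ) • φ ∧ E ≤ (hubbardTorus 2 L 1 U).minEnergyOn (szSector n 0) + τ}, (star (((pairField dWaveFormFactor L)ᴴ * pairField dWaveFormFactor L) *ᵥ v - ((lam * (L : ℝ) ^ 4 : ℝ) : ℂ) • v) ⬝ᵥ (((pairField dWaveFormFactor L)ᴴ * pairField dWaveFormFactor L) *ᵥ v - ((lam * (L : ℝ) ^ 4 : ℝ) : ℂ) • v)).re ≤ ρ ^ 2 * (L : ℝ) ^ 8 * (star v ⬝ᵥ v).re) → ∀ φ : Fock (Orb (FermionTorus 2 L)), φ ∈ szSector n 0 → star φ ⬝ᵥ φ = 1 → (expect (hubbardTorus 2 L 1 U) φ).re ≤ (hubbardTorus 2 L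 1 U).minEnergyOn (szSector n 0) + θ → B ≤ (expect ((pairField dWaveFormFactor L)ᴴ * pairField dWaveFormFactor L) φ).re → ∀ u ∈ Submodule.span ℂ {φ : Fock (Orb (FermionTorus 2 L)) | φ ∈ szSector n 0 ∧ ∃ E : ℝ, hubbardTorus 2 L 1 U *ᵥ φ = (E : ℂ) • φ ∧ E ≤ (hubbardTorus 2 L 1 U).minEnergyOn (szSector n 0) + τ}, star u ⬝ᵥ u = 1 → B - 4 * ρ * (L : ℝ) ^ 4 - K * (θ / τ) * (L : ℝ) ^ 4 ≤ (expect ((pairField dWaveFormFactor L)ᴴ * pairField dWaveFormFactor L) u).re))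
    (hCh : (∀ (G : ℕ → ℝ → Prop) (N m₀ : ℕ) (W F₀ ℓ Fmin : ℝ), Even N → Even m₀ → |(m₀ : ℝ) - (N : ℝ)| ≤ W → 2 ≤ m₀ → (∀ (m : ℕ) (F F' : ℝ), F' ≤ F → G m F → G m F') → G m₀ F₀ → (∀ (n : ℕ) (F : ℝ), Even n → N ≤ n → n + 2 ≤ m₀ → Fmin ≤ F → G (n + 2) F → G n (F - ℓ)) → (∀ (n : ℕ) (F : ℝ), Even n → m₀ ≤ n + 2 → n + 4 ≤ N → Fmin ≤ F → G (n + 2) F → G (n + 4) (F - ℓ)) → 0 ≤ ℓ → (∀ J' : ℝ, 0 ≤ J' → 2 * J' ≤ W → Fmin ≤ F₀ - J' * ℓ) → G N Fmin))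
    (U : ℝ) (L : ℕ) [NeZero L] (N m₀ : ℕ) (W F₀ Fmin Cr s τ ρ θ : ℝ)
    (hN : Even N) (hm₀ : Even m₀) (hW : |(m₀ : ℝ) - (N : ℝ)| ≤ W) (h2 : 2 ≤ m₀)
    (hhi : max m₀ N + 2 ≤ 2 * L ^ 2)
    (hCr : 0 ≤ Cr) (hs : 0 ≤ s) (hs1 : s ≤ 1) (hFmin : 0 < Fmin) (hCrF : 2 * Cr * (L : ℝ) ^ 2 ≤ Fmin)
    (hτ : 0 < τ) (hρ : 0 ≤ ρ) (hθ : s + 4 * Cr * (L : ℝ) ^ 2 / Fmin ≤ θ) (hθτ : 2 * θ ≤ τ)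
    (hRung : ∀ n : ℕ, Even n → min m₀ N ≤ n + 2 → n + 2 ≤ max m₀ N →
      ∀ ψ : Fock (Orb (FermionTorus 2 L)), IsGroundStateInSector (hubbardTorus 2 L 1 U) (n + 2) 0 ψ →
        star ψ ⬝ᵥ ψ = 1 → pairField dWaveFormFactor L *ᵥ ψ ∈ szSector n 0 ∧ (pairField dWaveFormFactor L)ᴴ *ᵥ ψ ∈ szSector (n + 4) 0 ∧ (expect (hubbardTorus 2 L 1 U) (pairField dWaveFormFactor L *ᵥ ψ)).re - (hubbardTorus 2 L 1 U).minEnergyOn (szSector n 0) * (expect ((pairField dWaveFormFactor L)ᴴ * pairField dWaveFormFactor L) ψ).re + ((expect (hubbardTorus 2 L 1 U) ((pairField dWaveFormFactor L)ᴴ *ᵥ ψ)).re - (hubbardTorus 2 L 1 U).minEnergyOn (szSector (n + 4) 0) * (expect (pairField dWaveFormFactor L * (pairField dWaveFormFactor L)ᴴ) ψ).re) ≤ Cr * (L : ℝ) ^ 2 + max 0 (2 * (hubbardTorus 2 L 1 U).minEnergyOn (szSector (n + 2) 0) - (hubbardTorus 2 L 1 U).minEnergyOn (szSector n 0) - (hubbardTorus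 2 L 1 U).minEnergyOn (szSector (n + 4) 0)) * (expect ((pairField dWaveFormFactor L)ᴴ * pairField dWaveFormFactor L) ψ).re ∧ (expect ((pairField dWaveFormFactor L)ᴴ * pairField dWaveFormFactor L) ψ).re ^ 2 - Cr * (L : ℝ) ^ 2 * (expect ((pairField dWaveFormFactor L)ᴴ * pairField dWaveFormFactor L) ψ).re ≤ (expect ((pairField dWaveFormFactor L)ᴴ * pairField dWaveFormFactor L) (pairField dWaveFormFactor L *ᵥ ψ)).re ∧ (expect (pairField dWaveFormFactor L * (pairField dWaveFormFactor L)ᴴ) ψ).re ^ 2 ≤ (expect ((pairField dWaveFormFactor L)ᴴ * pairField dWaveFormFactor L) ((pairField dWaveFormFactor L)ᴴ *ᵥ ψ)).re ∧ |(expect (pairField dWaveFormFactor L * (pairField dWaveFormFactor L)ᴴ) ψ).re - (expect ((pairField dWaveFormFactor L)ᴴ * pairField dWaveFormFactor L) ψ).re| ≤ Cr * (L : ℝ) ^ 2)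
    (hConv : ∀ n : ℕ, Even n → min m₀ N ≤ n + 2 → n + 2 ≤ max m₀ N →
      2 * (hubbardTorus 2 L 1 U).minEnergyOn (szSector (n + 2) 0) - (hubbardTorus 2 L 1 U).minEnergyOn (szSector n 0) -
        (hubbardTorus 2 L 1 U).minEnergyOn (szSector (n + 4) 0) ≤ s)
    (hRig : ∀ m : ℕ, Even m → min m₀ N ≤ m → m ≤ max m₀ N → ∃ lam : ℝ, (∀ v ∈ Submodule.span ℂ {φ : Fock (Orb (FermionTorus 2 L)) | φ ∈ szSector m 0 ∧ ∃ E : ℝ, hubbardTorus 2 L 1 U *ᵥ φ = (E : ℂ) • φ ∧ E ≤ (hubbardTorus 2 L 1 U).minEnergyOn (szSector m 0) + τ}, (star (((pairField dWaveFormFactor L)ᴴ * pairField dWaveFormFactor L) *ᵥ v - ((lam * (L : ℝ) ^ 4 : ℝ) : ℂ) • v) ⬝ᵥ (((pairField dWaveFormFactor L)ᴴ * pairField dWaveFormFactor L) *ᵥ v - ((lam * (L : ℝ) ^ 4 : ℝ) : ℂ) • v)).re ≤ ρ ^ 2 * (L : ℝ) ^ 8 * (star v ⬝ᵥ v).re)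)
    (hstart : ∀ ψ : Fock (Orb (FermionTorus 2 L)), IsGroundStateInSector (hubbardTorus 2 L 1 U) m₀ 0 ψ →
      star ψ ⬝ᵥ ψ = 1 → F₀ ≤ (expect ((pairField dWaveFormFactor L)ᴴ * pairField dWaveFormFactor L) ψ).re)
    (hbudget : ∀ J' : ℝ, 0 ≤ J' → 2 * J' ≤ W →
      Fmin ≤ F₀ - J' * (Cr * (L : ℝ) ^ 2 + 4 * ρ * (L : ℝ) ^ 4 + K * (θ / τ) * (L : ℝ) ^ 4)) :
    ∀ ψ : Fock (Orb (FermionTorus 2 L)), IsGroundStateInSector (hubbardTorus 2 L 1 U) N 0 ψ →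
      star ψ ⬝ᵥ ψ = 1 → Fmin ≤ (expect ((pairField dWaveFormFactor L)ᴴ * pairField dWaveFormFactor L) ψ).re := by
  set ℓ := Cr * (L : ℝ) ^ 2 + 4 * ρ * (L : ℝ) ^ 4 + K * (θ / τ) * (L : ℝ) ^ 4 with hℓ
  have hθ0 : 0 ≤ θ := by
    have : 0 ≤ 4 * Cr * (L : ℝ) ^ 2 / Fmin := by positivity
    linarith only [hθ, hs, this]
  have hℓ0 : 0 ≤ ℓ := by positivity
  -- per-rung side condition `s + 4C_rL²/F ≤ θ` for every admissible floor `F ≥ F_min`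
  have hθF : ∀ F : ℝ, Fmin ≤ F → s + 4 * Cr * (L : ℝ) ^ 2 / F ≤ θ := by
    intro F hF
    have hF0 : 0 < F := hFmin.trans_le hF
    have : 4 * Cr * (L : ℝ) ^ 2 / F ≤ 4 * Cr * (L : ℝ) ^ 2 / Fmin :=
      div_le_div_of_nonneg_left (by positivity) hFmin hF
    linarith only [hθ, this]
  refine hCh (fun m F => ∀ ψ : Fock (Orb (FermionTorus 2 L)), IsGroundStateInSector (hubbardTorus 2 L 1 U) m 0 ψ →
      star ψ ⬝ᵥ ψ = 1 → F ≤ (expect ((pairField dWaveFormFactor L)ᴴ * pairField dWaveFormFactor L) ψ).re)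
    N m₀ W F₀ ℓ Fmin hN hm₀ hW h2 ?mono hstart ?down ?up hℓ0 hbudget
  · -- antitone in the floor
    intro m F F' hFF' hG ψ hψ hψ1
    exact hFF'.trans (hG ψ hψ hψ1)
  · -- DOWN rung `n + 2 ↦ n`
    intro n F hn hNn hnm hFminF hG ψ hψ hψ1
    have hF0 : 0 < F := hFmin.trans_le hFminF
    have hlo : min m₀ N ≤ n + 2 := (min_le_right _ _).trans (hNn.trans (Nat.le_add_right n 2))
    have hhi' : n + 2 ≤ max m₀ N := hnm.trans (le_max_left _ _)
    have hn4 : n + 4 ≤ 2 * L ^ 2 := by omega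
    obtain ⟨lam, hlam⟩ := hRig n hn ((min_le_right _ _).trans hNn) ((Nat.le_add_right n 2).trans hhi')
    have hR : ∀ ψ : Fock (Orb (FermionTorus 2 L)), IsGroundStateInSector (hubbardTorus 2 L 1 U) (n + 2) 0 ψ →
        star ψ ⬝ᵥ ψ = 1 → pairField dWaveFormFactor L *ᵥ ψ ∈ szSector n 0 ∧ (pairField dWaveFormFactor L)ᴴ *ᵥ ψ ∈ szSector (n + 4) 0 ∧ (expect (hubbardTorus 2 L 1 U) (pairField dWaveFormFactor L *ᵥ ψ)).re - (hubbardTorus 2 L 1 U).minEnergyOn (szSector n 0) * (expect ((pairField dWaveFormFactor L)ᴴ * pairField dWaveFormFactor L) ψ).re + ((expect (hubbardTorus 2 L 1 U) ((pairField dWaveFormFactor L)ᴴ *ᵥ ψ)).re - (hubbardTorus 2 L 1 U).minEnergyOn (szSector (n + 4) 0) * (expect (pairField dWaveFormFactor L * (pairField dWaveFormFactor L)ᴴ) ψ).re) ≤ Cr * (L : ℝ) ^ 2 + max 0 (2 * (hubbardTorus 2 L 1 U).minEnergyOn (szSector (n + 2) 0) - (hubbardTorus 2 L 1 U).minEnergyOn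 (szSector n 0) - (hubbardTorus 2 L 1 U).minEnergyOn (szSector (n + 4) 0)) * (expect ((pairField dWaveFormFactor L)ᴴ * pairField dWaveFormFactor L) ψ).re ∧ (expect ((pairField dWaveFormFactor L)ᴴ * pairField dWaveFormFactor L) ψ).re ^ 2 - Cr * (L : ℝ) ^ 2 * (expect ((pairField dWaveFormFactor L)ᴴ * pairField dWaveFormFactor L) ψ).re ≤ (expect ((pairField dWaveFormFactor L)ᴴ * pairField dWaveFormFactor L) (pairField dWaveFormFactor L *ᵥ ψ)).re := by
      intro ψ hψ hψ1
      obtain ⟨r1, r2, r3, r4, -, -⟩ := hRung n hn hlo hhi' ψ hψ hψ1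
      exact ⟨r1, r2, r3, r4⟩
    have key := stub_ladderInductionRungDown K hT U L n Cr s F τ ρ θ lam hn hn4 hCr hs hs1 hF0
      (hCrF.trans hFminF) hτ hρ (hθF F hFminF) hθτ hR (hConv n hn hlo hhi') hG hlam ψ
      (lis_groundState_mem_lowManifold hτ.le hψ) hψ1
    rw [hℓ]
    linarith only [key]
  · -- UP rung `n + 2 ↦ n + 4`
    intro n F hn hmn hnN hFminF hG ψ hψ hψ1
    have hF0 : 0 < F := hFmin.trans_le hFminF
    have hlo : min m₀ N ≤ n + 2 := (min_le_left _ _).trans hmn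
    have hhi' : n + 2 ≤ max m₀ N := by
      have : n + 2 ≤ N := by omega
      exact this.trans (le_max_right _ _)
    have hn4 : n + 4 ≤ 2 * L ^ 2 := by
      have : N ≤ max m₀ N := le_max_right _ _
      omega
    have hn4e : Even (n + 4) := by
      obtain ⟨r, hr⟩ := hn
      exact ⟨r + 2, by omega⟩
    obtain ⟨lam, hlam⟩ := hRig (n + 4) hn4e ((min_le_left _ _).trans (hmn.trans (by omega)))
      (hnN.trans (le_max_right _ _))
    have key := stub_ladderInductionRungUp K hT U L n Cr s F τ ρ θ lam hn hn4 hCr hs hs1 hF0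
      (hCrF.trans hFminF) hτ hρ (hθF F hFminF) hθτ (hRung n hn hlo hhi') (hConv n hn hlo hhi') hG hlam ψ
      (lis_groundState_mem_lowManifold hτ.le hψ) hψ1
    rw [hℓ]
    linarith only [key]

/-- **SEED STEP — registered closed form** (`stub_ladderSeedStep`, INDUCTION helper of line
floating-mu-two-sided-pair-transfer): `lil_seed_floor` with all hypotheses as arrows. Koma–Tasaki (1994) §2.
[folklore] -/
theorem stub_ladderSeedStep :
    ∀ (K : ℝ), (∀ (U : ℝ) (L : ℕ) [NeZero L] (n : ℕ) (τ ρ θ B lam : ℝ), 0 < τ → 0 ≤ ρ → 0 ≤ θ → 2 * θ ≤ τ → (∀ v ∈ Submodule.span ℂ {φ : Fock (Orb (FermionTorus 2 L)) | φ ∈ szSector n 0 ∧ ∃ E : ℝ, hubbardTorus 2 L 1 U *ᵥ φ = (E : ℂ) • φ ∧ E ≤ (hubbardTorus 2 L 1 U).minEnergyOn (szSector n 0) + τ}, (star (((pairField dWaveFormFactor L)ᴴ * pairField dWaveFormFactor L) *ᵥ v - ((lam * (L : ℝ) ^ 4 : ℝ) : ℂ) • v) ⬝ᵥ (((pairField dWaveFormFactor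 L)ᴴ * pairField dWaveFormFactor L) *ᵥ v - ((lam * (L : ℝ) ^ 4 : ℝ) : ℂ) • v)).re ≤ ρ ^ 2 * (L : ℝ) ^ 8 * (star v ⬝ᵥ v).re) → ∀ φ : Fock (Orb (FermionTorus 2 L)), φ ∈ szSector n 0 → star φ ⬝ᵥ φ = 1 → (expect (hubbardTorus 2 L 1 U) φ).re ≤ (hubbardTorus 2 L 1 U).minEnergyOn (szSector n 0) + θ → B ≤ (expect ((pairField dWaveFormFactor L)ᴴ * pairField dWaveFormFactor L) φ).re → ∀ u ∈ Submodule.span ℂ {φ : Fock (Orb (FermionTorus 2 L)) | φ ∈ szSector n 0 ∧ ∃ E : ℝ, hubbardTorus 2 L 1 U *ᵥ φ = (E : ℂ) • φ ∧ E ≤ (hubbardTorus 2 L 1 U).minEnergyOn (szSector n 0) + τ}, star u ⬝ᵥ u = 1 → B - 4 * ρ * (L : ℝ) ^ 4 - K * (θ / τ) * (L : ℝ) ^ 4 ≤ (expect ((pairField dWaveFormFactor L)ᴴ * pairField dWaveFormFactor L) u).re) → ∀ (U : ℝ) (L : ℕ) [NeZero L] (m : ℕ) (τ ρ θ₀ B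 lam : ℝ), 0 < τ → 0 ≤ ρ → 0 ≤ θ₀ → 2 * θ₀ ≤ τ → (∀ v ∈ Submodule.span ℂ {φ : Fock (Orb (FermionTorus 2 L)) | φ ∈ szSector m 0 ∧ ∃ E : ℝ, hubbardTorus 2 L 1 U *ᵥ φ = (E : ℂ) • φ ∧ E ≤ (hubbardTorus 2 L 1 U).minEnergyOn (szSector m 0) + τ}, (star (((pairField dWaveFormFactor L)ᴴ * pairField dWaveFormFactor L) *ᵥ v - ((lam * (L : ℝ) ^ 4 : ℝ) : ℂ) • v) ⬝ᵥ (((pairField dWaveFormFactor L)ᴴ * pairField dWaveFormFactor L) *ᵥ v - ((lam * (L : ℝ) ^ 4 : ℝ) : ℂ) • v)).re ≤ ρ ^ 2 * (L : ℝ) ^ 8 * (star v ⬝ᵥ v).re) → ∀ φ : Fock (Orb (FermionTorus 2 L)), φ ∈ szSector m 0 → star φ ⬝ᵥ φ = 1 → (expect (hubbardTorus 2 L 1 U) φ).re ≤ (hubbardTorus 2 L 1 U).minEnergyOn (szSector m 0) + θ₀ → B ≤ (expect ((pairField dWaveFormFactor L)ᴴ * pairField dWaveFormFactor L) φ).re →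 ∀ ψ : Fock (Orb (FermionTorus 2 L)), IsGroundStateInSector (hubbardTorus 2 L 1 U) m 0 ψ → star ψ ⬝ᵥ ψ = 1 → B - 4 * ρ * (L : ℝ) ^ 4 - K * (θ₀ / τ) * (L : ℝ) ^ 4 ≤ (expect ((pairField dWaveFormFactor L)ᴴ * pairField dWaveFormFactor L) ψ).re :=
  fun _ hT U L _ m τ ρ θ₀ B lam hτ hρ hθ hθτ hrig _ hφ hφ1 hφE hφB =>
    lil_seed_floor hT U L m (τ := τ) (ρ := ρ) (θ₀ := θ₀) (B := B) (lam := lam) hτ hρ hθ hθτ hrig hφ hφ1 hφE hφB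

end Summit.HubbardSuperconductivity.HubbardSuperconductivity.Theorems

end
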